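import Literature.Probability.Distributions.GaussianPiDensity
import Literature.Probability.Distributions.GaussianWickTheorem
import Summits.QuantumFields.YangMills.Theorems.AllWindowsColdBoxBoxHighLineGaussianMoments

/-!
# T-S5.4ℓ «Gaussian chart ↔ product Gaussian, and Wick's theorem of every order in the T-S5.4 chart»

Untabled brick of step (1b)/(2) (planner ym-idea-2 g17, `STUB-PLAN-S5U5-STEP1b.md` §3) for the XL comparison stubs S5 (LINE-19
⟨stmt-QuantumFields-24004⟩/⟨24335⟩, `stub_landauSecondOrder`) and U5 (LINE-20 ⟨24336⟩, `stub_landauThirdOrder`).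

After T-S5.4 every expectation of the second-order expansion is taken against the DENSITY-FORM Gaussian of ✓T-S5.4a
`gaussianDeterminantFormula`: `v ↦ exp(−β ‖M v‖²) dv` on `Fin n → ℝ` (`M = fpOperator H U`).  The tree's Wick engine
(✓`Literature.Probability.Distributions.GaussianWick.integral_prod_eq_pairingSum`, Janson Thm 1.28 / Glimm–Jaffe §8.2) speaks about
centred Gaussian PROCESSES under a probability measure.  This file is the bridge, so that the S5 builder gets every Gaussian moment in
the chart for free:

* `withDensity_exp_eq_smul_pi` — the measure identity `e^{−β w⬝w} dw = √(π/β)ⁿ · P_β`, `P_β := ⊗ⁿ N(0, (2β)⁻¹)` (from the tree's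
  ✓`pi_gaussianReal_eq_smul_withDensity`);
* **`integral_mul_exp_eq_integral_pi`** — TRANSFER, for EVERY `F` (no measurability needed):
  `∫ F(v) exp(−β ‖Mv‖²) dv = √(π/β)ⁿ/|det M| · ∫ F(M⁻¹ w) dP_β(w)` (linear change of variables as a measurable equivalence +
  the measure identity);
* `isGaussianProcess_legs` — under `P_β` the legs `X_ℓ(w) = ℓ ⬝ᵥ (M⁻¹ w)` (`ℓ : Fin n → ℝ`, i.e. all linear functionals of
  `v = M⁻¹ w`) form a Gaussian process (Mathlib `iIndepFun_pi` + `iIndepFun.hasGaussianLaw` + `HasGaussianLaw.map`), centred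
  (`integral_leg_eq_zero`), with two-point function `(2β)⁻¹ · (ℓ ᵥ* M⁻¹) ⬝ᵥ (ℓ' ᵥ* M⁻¹) = (2β)⁻¹ · ℓ ⬝ᵥ (MᵀM)⁻¹ ℓ'`
  (`integral_leg_mul_leg`, via the pair moments of ✓T-S5.4h `integral_coord_mul_coord_mul_exp`);
* **`integral_prod_dotProduct_mul_exp_eq_pairingSum`** — WICK IN THE CHART: for `2k` linear forms `ℓ_i`,
  `∫ (∏_i ℓ_i ⬝ᵥ v) exp(−β ‖Mv‖²) dv = √(π/β)ⁿ/|det M| · 𝒢_k[(2β)⁻¹ ·⬝(MᵀM)⁻¹·](ℓ)` (the tree's pairing functional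
  `Literature.Probability.LatticeModels.pairingSum`), and `integral_prod_dotProduct_mul_exp_odd` — odd products integrate to `0`;
  the cases `k = 1, 2` spelled out (`integral_dotProduct_mul_dotProduct_mul_exp`, `integral_four_dotProduct_mul_exp`).

Tree (✓GaussianPiDensity, ✓GaussianWickTheorem, ✓…GaussianMoments) + Mathlib; no definitions.  HONEST LABEL: infrastructure for step
(1b)/(2) of the XL stubs S5/U5; T-S5.4 proper, S5, U5, ⟨24004⟩ ⟨24335⟩ ⟨24336⟩ remain OPEN; no summit is proved; the Yang–Mills mass gap
is NOT proved by this file.  Seat ym-line-sfw-p2 g77 (LEAD, cell ym-idea-1).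
-/

set_option autoImplicit false

noncomputable section

open MeasureTheory ProbabilityTheory Matrix Finset
open scoped NNReal ENNReal
open Literature.Probability.Distributions
open Literature.Probability.LatticeModels (pairingSum pairingSum_congr_of_eq)

namespace Summit.QuantumFields.YangMills.Theorems.AllWindowsColdBoxBoxHighLine

namespace GaussianChartWick

variable {n : ℕ}

/-! ## The reference product Gaussian `P_β = ⊗ⁿ N(0, (2β)⁻¹)` -/

/-- The variance `(2β)⁻¹` read back from `ℝ≥0`. -/
theorem coe_var {β : ℝ} (hβ : 0 < β) : ((Real.toNNReal (2 * β)⁻¹ : ℝ≥0) : ℝ) = (2 * β)⁻¹ :=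
  Real.coe_toNNReal _ (by positivity)

/-- The variance `(2β)⁻¹` is nonzero. -/
theorem var_ne_zero {β : ℝ} (hβ : 0 < β) : Real.toNNReal (2 * β)⁻¹ ≠ 0 := by
  have : (0 : ℝ) < (2 * β)⁻¹ := by positivity
  intro h
  rw [Real.toNNReal_eq_zero] at h
  linarith

/-- **The density identity**: `e^{−β w⬝w} dw = √(π/β)ⁿ · ⊗ⁿ N(0, (2β)⁻¹)` as measures on `Fin n → ℝ`. -/
theorem withDensity_exp_eq_smul_pi {β : ℝ} (hβ : 0 < β) :
    (volume : Measure (Fin n → ℝ)).withDensity (fun w => ENNReal.ofReal (Real.exp (-(β * (w ⬝ᵥ w))))) =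
      ENNReal.ofReal (Real.sqrt (Real.pi / β) ^ n) •
        Measure.pi (fun _ : Fin n => gaussianReal 0 (Real.toNNReal (2 * β)⁻¹)) := by
  have hv := var_ne_zero hβ
  rw [pi_gaussianReal_eq_smul_withDensity n hv]
  have hdens : (fun ω : Fin n → ℝ =>
      ENNReal.ofReal (Real.exp (-(∑ i, ω i ^ 2 / 2) / ((Real.toNNReal (2 * β)⁻¹ : ℝ≥0) : ℝ)))) =
      fun w => ENNReal.ofReal (Real.exp (-(β * (w ⬝ᵥ w)))) := by
    funext w
    rw [coe_var hβ]
    congr 2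
    have hne : (2 * β)⁻¹ ≠ 0 := by positivity
    have hsum : (∑ i, w i ^ 2 / 2) / (2 * β)⁻¹ = β * (w ⬝ᵥ w) := by
      rw [div_eq_iff hne, dotProduct, Finset.mul_sum, Finset.sum_mul]
      refine Finset.sum_congr rfl fun i _ => ?_
      field_simp
    rw [neg_div, hsum]
  rw [hdens, smul_smul, ← ENNReal.ofReal_mul (by positivity)]
  have hc : Real.sqrt (Real.pi / β) ^ n * (Real.sqrt (2 * Real.pi * ((Real.toNNReal (2 * β)⁻¹ : ℝ≥0) : ℝ)))⁻¹ ^ n = 1 := by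
    rw [coe_var hβ, show 2 * Real.pi * (2 * β)⁻¹ = Real.pi / β by field_simp, ← mul_pow,
      mul_inv_cancel₀ (Real.sqrt_pos.2 (by positivity)).ne', one_pow]
  rw [hc, ENNReal.ofReal_one, one_smul]

/-! ## Transfer: the chart integral against `exp(−β‖Mv‖²) dv` is an integral against `P_β` -/

/-- The linear change of variables `v ↦ M v` as a measurable equivalence (for `det M ≠ 0`). -/
theorem exists_measurableEquiv_mulVec (M : Matrix (Fin n) (Fin n) ℝ) (hM : M.det ≠ 0) :
    ∃ e : (Fin n → ℝ) ≃ᵐ (Fin n → ℝ), (∀ v, e v = M *ᵥ v) ∧ ∀ w, e.symm w = M⁻¹ *ᵥ w := by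
  have hMu : IsUnit M.det := isUnit_iff_ne_zero.mpr hM
  let eqv : (Fin n → ℝ) ≃ (Fin n → ℝ) :=
    ⟨fun v => M *ᵥ v, fun w => M⁻¹ *ᵥ w,
      fun v => by simp [Matrix.mulVec_mulVec, Matrix.nonsing_inv_mul _ hMu],
      fun w => by simp [Matrix.mulVec_mulVec, Matrix.mul_nonsing_inv _ hMu]⟩
  have hm : Measurable (fun v : Fin n → ℝ => M *ᵥ v) :=
    ((Matrix.toLin' M).continuous_of_finiteDimensional.congr fun v => Matrix.toLin'_apply M v).measurable
  have hm' : Measurable (fun w : Fin n → ℝ => M⁻¹ *ᵥ w) :=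
    ((Matrix.toLin' M⁻¹).continuous_of_finiteDimensional.congr fun v => Matrix.toLin'_apply M⁻¹ v).measurable
  exact ⟨⟨eqv, hm, hm'⟩, fun v => rfl, fun w => rfl⟩

/-- **TRANSFER** (every `F`, no measurability needed): `∫ F(v) exp(−β ‖Mv‖²) dv = √(π/β)ⁿ/|det M| · ∫ F(M⁻¹ w) dP_β(w)`. -/
theorem integral_mul_exp_eq_integral_pi (M : Matrix (Fin n) (Fin n) ℝ) (hM : M.det ≠ 0) {β : ℝ} (hβ : 0 < β)
    (F : (Fin n → ℝ) → ℝ) :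
    ∫ v, F v * Real.exp (-(β * (M *ᵥ v ⬝ᵥ M *ᵥ v))) =
      Real.sqrt (Real.pi / β) ^ n / |M.det| *
        ∫ w, F (M⁻¹ *ᵥ w) ∂(Measure.pi (fun _ : Fin n => gaussianReal 0 (Real.toNNReal (2 * β)⁻¹))) := by
  have hMu : IsUnit M.det := isUnit_iff_ne_zero.mpr hM
  obtain ⟨e, he, he'⟩ := exists_measurableEquiv_mulVec M hM
  set g : (Fin n → ℝ) → ℝ := fun w => Real.exp (-(β * (w ⬝ᵥ w))) * F (M⁻¹ *ᵥ w) with hg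
  -- pointwise: the integrand is `g ∘ e`
  have h1 : (fun v => F v * Real.exp (-(β * (M *ᵥ v ⬝ᵥ M *ᵥ v)))) = fun v => g (e v) := by
    funext v
    show F v * _ = Real.exp (-(β * (e v ⬝ᵥ e v))) * F (M⁻¹ *ᵥ e v)
    rw [he, Matrix.mulVec_mulVec, Matrix.nonsing_inv_mul _ hMu, Matrix.one_mulVec, mul_comm]
  -- `map e volume = |det M|⁻¹ • volume`
  have hmap : Measure.map e (volume : Measure (Fin n → ℝ)) = ENNReal.ofReal |M.det|⁻¹ • volume := by
    have hfe : (e : (Fin n → ℝ) → (Fin n → ℝ)) = Matrix.toLin' M := by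
      funext v; rw [he, Matrix.toLin'_apply]
    rw [hfe, Real.map_matrix_volume_pi_eq_smul_volume_pi hM, abs_inv]
  -- the density step
  have hdens : ∫ w, g w = Real.sqrt (Real.pi / β) ^ n *
      ∫ w, F (M⁻¹ *ᵥ w) ∂(Measure.pi (fun _ : Fin n => gaussianReal 0 (Real.toNNReal (2 * β)⁻¹))) := by
    have h := integral_withDensity_eq_integral_toReal_smul (μ := (volume : Measure (Fin n → ℝ)))
      (f := fun w => ENNReal.ofReal (Real.exp (-(β * (w ⬝ᵥ w)))))
      (by fun_prop) (Filter.Eventually.of_forall fun _ => ENNReal.ofReal_lt_top) (fun w => F (M⁻¹ *ᵥ w))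
    simp only [ENNReal.toReal_ofReal (Real.exp_pos _).le, smul_eq_mul] at h
    rw [withDensity_exp_eq_smul_pi hβ, integral_smul_measure, ENNReal.toReal_ofReal (by positivity), smul_eq_mul] at h
    exact h.symm
  rw [h1, ← integral_map_equiv e g, hmap, integral_smul_measure, ENNReal.toReal_ofReal (by positivity), smul_eq_mul,
    hdens]
  ring

/-! ## The legs `X_ℓ(w) = ℓ ⬝ᵥ (M⁻¹ w)` form a centred Gaussian process under `P_β` -/

/-- Each coordinate has Gaussian law `N(0, (2β)⁻¹)` under `P_β`. -/
theorem hasGaussianLaw_eval (β : ℝ) (i : Fin n) :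
    HasGaussianLaw (fun w : Fin n → ℝ => w i) (Measure.pi (fun _ : Fin n => gaussianReal 0 (Real.toNNReal (2 * β)⁻¹))) := by
  have hmp := measurePreserving_eval (μ := fun _ : Fin n => gaussianReal 0 (Real.toNNReal (2 * β)⁻¹)) i
  exact HasLaw.hasGaussianLaw (μ := gaussianReal 0 (Real.toNNReal (2 * β)⁻¹)) ⟨hmp.measurable.aemeasurable, hmp.map_eq⟩

/-- The coordinates are jointly Gaussian under `P_β` (independent Gaussians). -/
theorem hasGaussianLaw_pi (β : ℝ) :
    HasGaussianLaw (fun w : Fin n → ℝ => fun i => w i) (Measure.pi (fun _ : Fin n => gaussianReal 0 (Real.toNNReal (2 * β)⁻¹))) := by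
  have h2 : iIndepFun (fun i (w : Fin n → ℝ) => w i) (Measure.pi (fun _ : Fin n => gaussianReal 0 (Real.toNNReal (2 * β)⁻¹))) := by
    simpa using iIndepFun_pi (μ := fun _ : Fin n => gaussianReal 0 (Real.toNNReal (2 * β)⁻¹))
      (X := fun _ => (id : ℝ → ℝ)) (fun _ => aemeasurable_id)
  exact iIndepFun.hasGaussianLaw (fun i => hasGaussianLaw_eval β i) h2

/-- **The legs form a Gaussian process**: all linear functionals `ℓ ⬝ᵥ (M⁻¹ w)` of `v = M⁻¹ w` are jointly Gaussian under `P_β`. -/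
theorem isGaussianProcess_legs (M : Matrix (Fin n) (Fin n) ℝ) (β : ℝ) :
    IsGaussianProcess (fun (ℓ : Fin n → ℝ) (w : Fin n → ℝ) => ℓ ⬝ᵥ (M⁻¹ *ᵥ w))
      (Measure.pi (fun _ : Fin n => gaussianReal 0 (Real.toNNReal (2 * β)⁻¹))) := by
  refine ⟨fun I => ?_⟩
  let Llin : (Fin n → ℝ) →ₗ[ℝ] (↥I → ℝ) :=
    { toFun := fun w i => (i : Fin n → ℝ) ⬝ᵥ (M⁻¹ *ᵥ w)
      map_add' := fun w w' => by
        funext i; simp only [Matrix.mulVec_add, dotProduct_add, Pi.add_apply]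
      map_smul' := fun c w => by
        funext i; simp only [Matrix.mulVec_smul, dotProduct_smul, smul_eq_mul, RingHom.id_apply, Pi.smul_apply] }
  have h := (hasGaussianLaw_pi (n := n) β).map (LinearMap.toContinuousLinearMap Llin)
  have hfun : ((LinearMap.toContinuousLinearMap Llin) ∘ fun w : Fin n → ℝ => fun i => w i) =
      fun w => I.restrict fun ℓ : Fin n → ℝ => ℓ ⬝ᵥ (M⁻¹ *ᵥ w) := by
    funext w; rfl
  rwa [hfun] at h

/-- Each coordinate is centred under `P_β`. -/
theorem integral_eval_pi (β : ℝ) (j : Fin n) :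
    ∫ w, w j ∂(Measure.pi (fun _ : Fin n => gaussianReal 0 (Real.toNNReal (2 * β)⁻¹))) = 0 := by
  have hmp := measurePreserving_eval (μ := fun _ : Fin n => gaussianReal 0 (Real.toNNReal (2 * β)⁻¹)) j
  have h := integral_map (μ := Measure.pi (fun _ : Fin n => gaussianReal 0 (Real.toNNReal (2 * β)⁻¹)))
    (φ := fun w : Fin n → ℝ => w j) hmp.measurable.aemeasurable (f := fun x : ℝ => x) aestronglyMeasurable_id
  rw [hmp.map_eq, integral_id_gaussianReal] at h
  exact h.symm

/-- **The legs are centred**: `∫ ℓ ⬝ᵥ (M⁻¹ w) dP_β = 0`. -/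
theorem integral_leg_eq_zero (M : Matrix (Fin n) (Fin n) ℝ) (β : ℝ) (ℓ : Fin n → ℝ) :
    ∫ w, ℓ ⬝ᵥ (M⁻¹ *ᵥ w) ∂(Measure.pi (fun _ : Fin n => gaussianReal 0 (Real.toNNReal (2 * β)⁻¹))) = 0 := by
  have hexp : ∀ w : Fin n → ℝ, ℓ ⬝ᵥ (M⁻¹ *ᵥ w) = ∑ j, (ℓ ᵥ* M⁻¹) j * w j := fun w => by
    rw [Matrix.dotProduct_mulVec]; rfl
  simp_rw [hexp]
  rw [integral_finsetSum _ fun j _ => ((hasGaussianLaw_eval β j).integrable).const_mul _]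
  simp only [integral_const_mul, integral_eval_pi, mul_zero, Finset.sum_const_zero]

/-- The pair moments of `P_β`: `∫ w_j w_k dP_β = δ_{jk} (2β)⁻¹` (from ✓`integral_coord_mul_coord_mul_exp` by the transfer at `M = 1`). -/
theorem integral_eval_mul_eval_pi {β : ℝ} (hβ : 0 < β) (j k : Fin n) :
    ∫ w, w j * w k ∂(Measure.pi (fun _ : Fin n => gaussianReal 0 (Real.toNNReal (2 * β)⁻¹))) =
      if j = k then (2 * β)⁻¹ else 0 := by
  have h := integral_mul_exp_eq_integral_pi (1 : Matrix (Fin n) (Fin n) ℝ) (by simp) hβ (fun v => v j * v k)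
  simp only [Matrix.one_mulVec, inv_one, Matrix.det_one, abs_one, div_one] at h
  rw [integral_coord_mul_coord_mul_exp hβ] at h
  have hZ : (0 : ℝ) < Real.sqrt (Real.pi / β) ^ n := by positivity
  split_ifs at h ⊢ with hjk
  · have : Real.sqrt (Real.pi / β) ^ n * ((2 * β)⁻¹ -
        ∫ w, w j * w k ∂(Measure.pi (fun _ : Fin n => gaussianReal 0 (Real.toNNReal (2 * β)⁻¹)))) = 0 := by
      rw [mul_sub]; linarith
    rcases mul_eq_zero.1 this with h0 | h0
    · exact absurd h0 hZ.ne'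
    · linarith
  · rcases mul_eq_zero.1 h.symm with h0 | h0
    · exact absurd h0 hZ.ne'
    · exact h0

/-- **Two-point function of the legs**: `∫ (ℓ ⬝ᵥ M⁻¹w)(ℓ' ⬝ᵥ M⁻¹w) dP_β = (2β)⁻¹ · (ℓ ᵥ* M⁻¹) ⬝ᵥ (ℓ' ᵥ* M⁻¹)`. -/
theorem integral_leg_mul_leg (M : Matrix (Fin n) (Fin n) ℝ) {β : ℝ} (hβ : 0 < β) (ℓ ℓ' : Fin n → ℝ) :
    ∫ w, (ℓ ⬝ᵥ (M⁻¹ *ᵥ w)) * (ℓ' ⬝ᵥ (M⁻¹ *ᵥ w)) ∂(Measure.pi (fun _ : Fin n => gaussianReal 0 (Real.toNNReal (2 * β)⁻¹))) =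
      (2 * β)⁻¹ * ((ℓ ᵥ* M⁻¹) ⬝ᵥ (ℓ' ᵥ* M⁻¹)) := by
  set c : Fin n → ℝ := ℓ ᵥ* M⁻¹ with hc
  set d : Fin n → ℝ := ℓ' ᵥ* M⁻¹ with hd
  have hexp : ∀ w : Fin n → ℝ, (ℓ ⬝ᵥ (M⁻¹ *ᵥ w)) * (ℓ' ⬝ᵥ (M⁻¹ *ᵥ w)) = ∑ j, ∑ k, c j * d k * (w j * w k) := by
    intro w
    rw [Matrix.dotProduct_mulVec, Matrix.dotProduct_mulVec, ← hc, ← hd, dotProduct, dotProduct, Finset.sum_mul_sum]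
    refine Finset.sum_congr rfl fun j _ => Finset.sum_congr rfl fun k _ => ?_
    ring
  have hint : ∀ j k : Fin n, Integrable (fun w : Fin n → ℝ => w j * w k)
      (Measure.pi (fun _ : Fin n => gaussianReal 0 (Real.toNNReal (2 * β)⁻¹))) := fun j k =>
    (hasGaussianLaw_eval β j).memLp_two.integrable_mul (hasGaussianLaw_eval β k).memLp_two
  simp_rw [hexp]
  rw [integral_finsetSum _ fun j _ => integrable_finsetSum _ fun k _ => (hint j k).const_mul _]
  simp_rw [integral_finsetSum _ fun k _ => (hint _ k).const_mul _, integral_const_mul, integral_eval_mul_eval_pi hβ,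
    mul_ite, mul_zero, Finset.sum_ite_eq, Finset.mem_univ, if_true]
  rw [dotProduct, Finset.mul_sum]
  refine Finset.sum_congr rfl fun j _ => ?_
  ring

/-- The two-point function in the `(MᵀM)⁻¹` form: `(ℓ ᵥ* M⁻¹) ⬝ᵥ (ℓ' ᵥ* M⁻¹) = ℓ ⬝ᵥ (MᵀM)⁻¹ ℓ'`. -/
theorem vecMul_inv_dotProduct_vecMul_inv (M : Matrix (Fin n) (Fin n) ℝ) (ℓ ℓ' : Fin n → ℝ) :
    (ℓ ᵥ* M⁻¹) ⬝ᵥ (ℓ' ᵥ* M⁻¹) = ℓ ⬝ᵥ ((Mᵀ * M)⁻¹ *ᵥ ℓ') := by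
  rw [Matrix.mul_inv_rev, ← Matrix.transpose_nonsing_inv, ← Matrix.mulVec_mulVec, Matrix.mulVec_transpose,
    Matrix.dotProduct_mulVec]

/-! ## Wick's theorem in the chart -/

/-- **Wick for the legs under `P_β`**: `∫ ∏_{i<2k} (ℓ_i ⬝ᵥ M⁻¹w) dP_β = 𝒢_k[(2β)⁻¹ (· ᵥ* M⁻¹) ⬝ᵥ (· ᵥ* M⁻¹)](ℓ)`. -/
theorem integral_prod_legs_eq_pairingSum (M : Matrix (Fin n) (Fin n) ℝ) {β : ℝ} (hβ : 0 < β) (k : ℕ)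
    (ℓ : Fin (2 * k) → (Fin n → ℝ)) :
    ∫ w, ∏ i, (ℓ i ⬝ᵥ (M⁻¹ *ᵥ w)) ∂(Measure.pi (fun _ : Fin n => gaussianReal 0 (Real.toNNReal (2 * β)⁻¹))) =
      pairingSum (fun a b : Fin n → ℝ => (2 * β)⁻¹ * ((a ᵥ* M⁻¹) ⬝ᵥ (b ᵥ* M⁻¹))) k ℓ := by
  have h := GaussianWick.integral_prod_eq_pairingSum (isGaussianProcess_legs M β) (integral_leg_eq_zero M β) k ℓ
  rw [h]
  exact pairingSum_congr_of_eq _ _ k ℓ ℓ fun i j => integral_leg_mul_leg M hβ _ _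

/-- Odd products of legs integrate to zero under `P_β`. -/
theorem integral_prod_legs_odd (M : Matrix (Fin n) (Fin n) ℝ) (β : ℝ) (k : ℕ) (ℓ : Fin (2 * k + 1) → (Fin n → ℝ)) :
    ∫ w, ∏ i, (ℓ i ⬝ᵥ (M⁻¹ *ᵥ w)) ∂(Measure.pi (fun _ : Fin n => gaussianReal 0 (Real.toNNReal (2 * β)⁻¹))) = 0 :=
  GaussianWick.integral_prod_odd_eq_zero (isGaussianProcess_legs M β) (integral_leg_eq_zero M β) k ℓ

end GaussianChartWick

open GaussianChartWick

/-- **WICK'S THEOREM IN THE T-S5.4 CHART**: for an invertible `M`, `β > 0` and `2k` linear forms `ℓ_i`,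
`∫ (∏_i ℓ_i ⬝ᵥ v) exp(−β ‖Mv‖²) dv = √(π/β)ⁿ/|det M| · 𝒢_k[S](ℓ)` with the propagator `S(a, b) = (2β)⁻¹ · a ⬝ᵥ (MᵀM)⁻¹ b`
(`𝒢_k` = the tree's `pairingSum`: the sum over pairings of the products of propagators). -/
theorem integral_prod_dotProduct_mul_exp_eq_pairingSum (n : ℕ) (M : Matrix (Fin n) (Fin n) ℝ) (hM : M.det ≠ 0)
    {β : ℝ} (hβ : 0 < β) (k : ℕ) (ℓ : Fin (2 * k) → (Fin n → ℝ)) :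
    ∫ v : Fin n → ℝ, (∏ i, (ℓ i ⬝ᵥ v)) * Real.exp (-(β * (M *ᵥ v ⬝ᵥ M *ᵥ v))) =
      Real.sqrt (Real.pi / β) ^ n / |M.det| *
        pairingSum (fun a b : Fin n → ℝ => (2 * β)⁻¹ * (a ⬝ᵥ ((Mᵀ * M)⁻¹ *ᵥ b))) k ℓ := by
  rw [integral_mul_exp_eq_integral_pi M hM hβ (fun v => ∏ i, (ℓ i ⬝ᵥ v)), integral_prod_legs_eq_pairingSum M hβ k ℓ]
  congr 1
  exact pairingSum_congr_of_eq _ _ k ℓ ℓ fun i j => by rw [vecMul_inv_dotProduct_vecMul_inv]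

/-- **Odd moments vanish in the chart**: `∫ (∏_{i<2k+1} ℓ_i ⬝ᵥ v) exp(−β ‖Mv‖²) dv = 0`. -/
theorem integral_prod_dotProduct_mul_exp_odd (n : ℕ) (M : Matrix (Fin n) (Fin n) ℝ) (hM : M.det ≠ 0)
    {β : ℝ} (hβ : 0 < β) (k : ℕ) (ℓ : Fin (2 * k + 1) → (Fin n → ℝ)) :
    ∫ v : Fin n → ℝ, (∏ i, (ℓ i ⬝ᵥ v)) * Real.exp (-(β * (M *ᵥ v ⬝ᵥ M *ᵥ v))) = 0 := by
  rw [integral_mul_exp_eq_integral_pi M hM hβ (fun v => ∏ i, (ℓ i ⬝ᵥ v)), integral_prod_legs_odd M β k ℓ, mul_zero]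

/-- The case `k = 1` (propagator): `∫ (a ⬝ᵥ v)(b ⬝ᵥ v) exp(−β ‖Mv‖²) dv = √(π/β)ⁿ/|det M| · (2β)⁻¹ · a ⬝ᵥ (MᵀM)⁻¹ b`. -/
theorem integral_dotProduct_mul_dotProduct_mul_exp (n : ℕ) (M : Matrix (Fin n) (Fin n) ℝ) (hM : M.det ≠ 0)
    {β : ℝ} (hβ : 0 < β) (a b : Fin n → ℝ) :
    ∫ v : Fin n → ℝ, (a ⬝ᵥ v) * (b ⬝ᵥ v) * Real.exp (-(β * (M *ᵥ v ⬝ᵥ M *ᵥ v))) =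
      Real.sqrt (Real.pi / β) ^ n / |M.det| * ((2 * β)⁻¹ * (a ⬝ᵥ ((Mᵀ * M)⁻¹ *ᵥ b))) := by
  rw [integral_mul_exp_eq_integral_pi M hM hβ (fun v => (a ⬝ᵥ v) * (b ⬝ᵥ v)), integral_leg_mul_leg M hβ,
    vecMul_inv_dotProduct_vecMul_inv]

/-- The case `k = 2` (the three pairings): with `S(a,b) = (2β)⁻¹ · a ⬝ᵥ (MᵀM)⁻¹ b`,
`∫ (ℓ₀⬝v)(ℓ₁⬝v)(ℓ₂⬝v)(ℓ₃⬝v) exp(−β ‖Mv‖²) dv = √(π/β)ⁿ/|det M| · (S₀₁S₂₃ + S₀₂S₁₃ + S₀₃S₁₂)`. -/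
theorem integral_four_dotProduct_mul_exp (n : ℕ) (M : Matrix (Fin n) (Fin n) ℝ) (hM : M.det ≠ 0)
    {β : ℝ} (hβ : 0 < β) (ℓ₀ ℓ₁ ℓ₂ ℓ₃ : Fin n → ℝ) :
    ∫ v : Fin n → ℝ, (ℓ₀ ⬝ᵥ v) * (ℓ₁ ⬝ᵥ v) * (ℓ₂ ⬝ᵥ v) * (ℓ₃ ⬝ᵥ v) * Real.exp (-(β * (M *ᵥ v ⬝ᵥ M *ᵥ v))) =
      Real.sqrt (Real.pi / β) ^ n / |M.det| *
        (((2 * β)⁻¹ * (ℓ₀ ⬝ᵥ ((Mᵀ * M)⁻¹ *ᵥ ℓ₁))) * ((2 * β)⁻¹ * (ℓ₂ ⬝ᵥ ((Mᵀ * M)⁻¹ *ᵥ ℓ₃))) +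
         ((2 * β)⁻¹ * (ℓ₀ ⬝ᵥ ((Mᵀ * M)⁻¹ *ᵥ ℓ₂))) * ((2 * β)⁻¹ * (ℓ₁ ⬝ᵥ ((Mᵀ * M)⁻¹ *ᵥ ℓ₃))) +
         ((2 * β)⁻¹ * (ℓ₀ ⬝ᵥ ((Mᵀ * M)⁻¹ *ᵥ ℓ₃))) * ((2 * β)⁻¹ * (ℓ₁ ⬝ᵥ ((Mᵀ * M)⁻¹ *ᵥ ℓ₂)))) := by
  set x : Fin 4 → (Fin n → ℝ) := ![ℓ₀, ℓ₁, ℓ₂, ℓ₃] with hx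
  have h := GaussianWick.integral_prod_four (isGaussianProcess_legs M β) (integral_leg_eq_zero M β) x
  simp only [hx, Matrix.cons_val_zero, Matrix.cons_val_one, Matrix.cons_val] at h
  rw [integral_mul_exp_eq_integral_pi M hM hβ (fun v => (ℓ₀ ⬝ᵥ v) * (ℓ₁ ⬝ᵥ v) * (ℓ₂ ⬝ᵥ v) * (ℓ₃ ⬝ᵥ v)), h]
  simp only [integral_leg_mul_leg M hβ, vecMul_inv_dotProduct_vecMul_inv]

end Summit.QuantumFields.YangMills.Theorems.AllWindowsColdBoxBoxHighLine

end
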